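import Summits.BirchSwinnertonDyer.BirchSwinnertonDyer.Theorems.SmallImageMuTransferMuTransferX9LocalSplitPrime
import Literature.NumberTheory.EllipticCurves.IwasawaTwistModPk
import HarnessLib

set_option autoImplicit false

-- the summit and its single problem are both named `BirchSwinnertonDyer` (registry layout D-0017)
set_option linter.dupNamespace false

/-!
# Fixed points of `(1+S)^N` on the level-`p^k` carriers `Fin J → M` (`p^k • M = 0`): `#Fix((1+S)^N) ≤ #M^{p^m}` for
# `v_p(N) = m` — the uniform `H⁰`/`H²`-bound input of the local `T`-exponent at `v ∤ p` for `𝒯^{(k)}_J`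
# (service lemma for stub 1a' `stub_testCocyclePkLevelX9` of line `graded_euler_loss`, crux `KatoDivisibilityX9`)

Seat `bsd-line-k6-p4` (prover-bsd-line-k6-p4-g5-0, 5th LEAD on stmt-BirchSwinnertonDyer-20547).  THEOREMS ONLY, pure algebra,
sorry-free, no definition; `--supports stmt-BirchSwinnertonDyer-20547 --as helper`.  The `n = 0` local exponent at the bad primes
(`…X9LocalExponentBadPrimes`, `natCard_fixedPoints_toLocal_twistModP_le_of_depth`) bounds `#H⁰(K_v, 𝒯_J) ≤ #M^{p^m}` through the
fixed points of ONE `ρ`-trivial element of depth `m`, which acts on `𝒯_J` as `(1+S)^N`, `v_p(N) = m`; on a `p`-TORSION module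
`(1+S)^{p^m} = 1 + S^{p^m}` and the fixed points are `𝒯_J[T^{p^m}]`.  At level `p^k` (`p^k • M = 0`) `(1+S)^{p^m} − 1` is no
longer a power of `S`; this file proves the same BOUND by induction on `k` along `0 → M[p] → M → M/M[p] → 0`:
* `unipotentPow_apply_eq_self_iff_of_coprime` — `Fix((1+S)^{p^m·u}) = Fix((1+S)^{p^m})` for `p ∤ u` (raise to a power
  `u·u' ≡ 1 (mod p^a)` with `(1+S)^{p^{m+a}} = 1`);
* `unipotentPow_prime_pow_apply_eq_self_iff_of_torsion` — on `p`-torsion `M`: `(1+S)^{p^m} x = x ↔ S^{p^m} x = 0`;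
* `natCard_fixed_unipotentPow_prime_pow_le` — `#{x : (1+S)^{p^m} x = x} ≤ #M^{p^m}` for every finite `M` with `p^k • M = 0`;
* `natCard_fixed_unipotentPow_le_of_coprime` — the same for `(1+S)^{p^m·u}`, `p ∤ u`.
HONEST LABEL: closes nothing; BSD is not proved by any of this; no summit statement is proved by this seat.
References: L. Washington, GTM 83 §13.1–13.2 [Washington1997]; B. Mazur, K. Rubin, Mem. AMS 799 (2004) Lemma 5.3.1 [MazurRubin2004].
-/

noncomputable section

open scoped Classical
open Literature.NumberTheory.EllipticCurves Function
open Summit.BirchSwinnertonDyer.BirchSwinnertonDyer.Rank1Residual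

namespace Summit.BirchSwinnertonDyer.BirchSwinnertonDyer.Theorems.OneSidedTwistSqueezeX9KatoDivisibilityX9UnipotentFixedPointsPk

universe u

variable {p : ℕ} [Fact p.Prime]

/-! ## §1 Reduction to `N = p^m` -/

/-- `(1+S)^{a·b} = ((1+S)^a)^b` applied: if `(1+S)^a x = x` then `(1+S)^{a·b} x = x`. [cite: Washington1997, §13.1–§13.2] -/
theorem unipotentPow_mul_apply_eq_self {M : Type*} [AddCommGroup M] {J : ℕ} (a b : ℕ) (x : Fin J → M)
    (hx : unipotentPow M J a x = x) : unipotentPow M J (a * b) x = x := by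
  induction b with
  | zero => rw [mul_zero, unipotentPow, pow_zero, Module.End.one_apply]
  | succ b ih => rw [Nat.mul_succ, unipotentPow_add, Module.End.mul_apply, hx, ih]

/-- **Reduction to `N = p^m`.**  On `Fin J → M` with `p^k • M = 0` and `p ∤ u`: `(1+S)^{p^m u} x = x ↔ (1+S)^{p^m} x = x`
(`⇒`: take `u'` with `u u' ≡ 1 (mod p^a)`, `J ≤ p^{m+a+1−k}`; then `(1+S)^{p^m u u'} = (1+S)^{p^m}`).
[cite: Washington1997, §13.1–§13.2] -/
theorem unipotentPow_apply_eq_self_iff_of_coprime {M : Type*} [AddCommGroup M] {J k : ℕ}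
    (hM : ∀ x : M, p ^ k • x = 0) {m u : ℕ} (hu : ¬ p ∣ u) (x : Fin J → M) :
    unipotentPow M J (p ^ m * u) x = x ↔ unipotentPow M J (p ^ m) x = x := by
  have hp : p.Prime := Fact.out
  refine ⟨fun hx => ?_, fun hx => unipotentPow_mul_apply_eq_self _ _ x hx⟩
  -- `a` with `J ≤ p^{(m + a) + 1 - k}`: take `a := J + k`
  have hJ : J ≤ p ^ (m + (J + k) + 1 - k) := by
    have h1 : J ≤ p ^ J := (Nat.lt_pow_self hp.one_lt).le
    exact h1.trans (Nat.pow_le_pow_right hp.pos (by omega))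
  have hcop : Nat.Coprime u (p ^ (J + k)) := (Nat.Coprime.pow_right _ ((Nat.Prime.coprime_iff_not_dvd hp).2 hu).symm)
  have hlt : 1 < p ^ (J + k) ∨ p ^ (J + k) = 1 := by
    rcases Nat.eq_zero_or_pos (J + k) with h0 | h0
    · right; rw [h0, pow_zero]
    · left; exact Nat.one_lt_pow h0.ne' hp.one_lt
  rcases hlt with hlt | hone
  · obtain ⟨u', -, hu'⟩ := Nat.exists_mul_mod_eq_one_of_coprime hcop hlt
    -- `u * u' = 1 + p^(J+k) * c`
    have hdecomp : u * u' = p ^ (J + k) * (u * u' / p ^ (J + k)) + 1 := by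
      have := Nat.div_add_mod (u * u') (p ^ (J + k))
      rw [hu'] at this
      exact this.symm
    have key : unipotentPow M J (p ^ m * (u * u')) = unipotentPow M J (p ^ m) := by
      rw [hdecomp, mul_add, mul_one, unipotentPow_add, ← mul_assoc, ← pow_add,
        unipotentPow_eq_one_of_dvd_of_pow_smul hM hJ (dvd_mul_right _ _), one_mul]
    have h2 := unipotentPow_mul_apply_eq_self (p ^ m * u) u' x hx
    rwa [mul_assoc, key] at h2
  · -- `p^(J+k) = 1` forces `J = 0` (`p > 1`), so `Fin J → M` is a subsingleton
    have hJ0 : J = 0 := by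
      by_contra hJ0
      have : 1 < p ^ (J + k) := Nat.one_lt_pow (by omega) hp.one_lt
      omega
    subst hJ0
    exact Subsingleton.elim _ _

/-! ## §2 The `p`-torsion case: `Fix((1+S)^{p^m}) = 𝒯_J[S^{p^m}]` -/

/-- On a `p`-torsion module, `(1+S)^{p^m} = 1 + S^{p^m}` (freshman's dream), so `(1+S)^{p^m} x = x ↔ S^{p^m} x = 0`.
[cite: Washington1997, §13.1–§13.2] -/
theorem unipotentPow_prime_pow_apply_eq_self_iff_of_torsion {M : Type*} [AddCommGroup M] {J : ℕ}
    (hM : ∀ x : M, p • x = 0) (m : ℕ) (x : Fin J → M) :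
    unipotentPow M J (p ^ m) x = x ↔ (shiftEnd M J ^ p ^ m) x = 0 := by
  have hR : ((p : ℕ) : Module.End ℤ (Fin J → M)) = 0 := by
    refine LinearMap.ext fun y => funext fun i => ?_
    rw [Module.End.natCast_apply, LinearMap.zero_apply, Pi.smul_apply, Pi.zero_apply, hM]
  rw [unipotentPow, one_add_pow_prime_pow_of_natCast_eq_zero (Fact.out : p.Prime) hR, LinearMap.add_apply,
    Module.End.one_apply, add_eq_left]

/-- The `p`-torsion count: `#Fix((1+S)^{p^m}) ≤ #M^{p^m}` (`= 𝒯_J[S^{p^m}]`, of order `#M^{min(J, p^m)}`).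
[cite: Washington1997, §13.1–§13.2] -/
theorem natCard_fixed_unipotentPow_prime_pow_le_of_torsion {M : Type u} [AddCommGroup M] [Finite M] {J : ℕ}
    (hM : ∀ x : M, p • x = 0) (m : ℕ) :
    Nat.card {x : Fin J → M // unipotentPow M J (p ^ m) x = x} ≤ Nat.card M ^ p ^ m := by
  have hMpos : 0 < Nat.card M := Nat.card_pos
  rw [Nat.card_congr (Equiv.subtypeEquivRight fun x => unipotentPow_prime_pow_apply_eq_self_iff_of_torsion hM m x)]
  by_cases hpm : p ^ m ≤ J
  · rw [LocalSplitPrime.natCard_shiftEnd_pow_ker J hpm]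
  · calc Nat.card {x : Fin J → M // (shiftEnd M J ^ p ^ m) x = 0}
        ≤ Nat.card (Fin J → M) := Nat.card_le_card_of_injective (fun x => x.1) Subtype.val_injective
      _ = Nat.card M ^ J := by rw [Nat.card_fun, Nat.card_fin]
      _ ≤ Nat.card M ^ p ^ m := Nat.pow_le_pow_right hMpos (by omega)

/-! ## §3 The level-`p^k` count by induction on `k` -/

/-- One induction step of the count: for an additive subgroup `N ≤ M` stable under nothing in particular, the fixed points
of `(1+S)^a` on `Fin J → M` are at most `#Fix on (Fin J → N) · #Fix on (Fin J → M ⧸ N)` (left exactness of fixed points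
along `0 → N → M → M/N → 0`, `(1+S)^a` being natural in `M`). [folklore] -/
theorem natCard_fixed_unipotentPow_le_mul {M : Type u} [AddCommGroup M] [Finite M] {J : ℕ} (N : AddSubgroup M) (a : ℕ) :
    Nat.card {x : Fin J → M // unipotentPow M J a x = x} ≤
      Nat.card {y : Fin J → N // unipotentPow N J a y = y} *
        Nat.card {z : Fin J → M ⧸ N // unipotentPow (M ⧸ N) J a z = z} := by
  -- the fixed subgroup `F` of `M`, and the projection `π : F → (Fin J → M ⧸ N)`
  let U : (Fin J → M) →+ (Fin J → M) := (unipotentPow M J a).toAddMonoidHom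
  let F : AddSubgroup (Fin J → M) := (U - AddMonoidHom.id (Fin J → M)).ker
  have hF : ∀ x, x ∈ F ↔ unipotentPow M J a x = x := fun x => by
    change (U - AddMonoidHom.id (Fin J → M)) x = 0 ↔ _
    rw [AddMonoidHom.sub_apply, AddMonoidHom.id_apply, sub_eq_zero]
    rfl
  let πM : (Fin J → M) →+ (Fin J → M ⧸ N) := (QuotientAddGroup.mk' N).compLeft (Fin J)
  let π : F →+ (Fin J → M ⧸ N) := πM.comp F.subtype
  -- `#F = #ker π · #range π`
  have hcard : Nat.card F = Nat.card π.ker * Nat.card π.range := by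
    rw [← Nat.card_congr (QuotientAddGroup.quotientKerEquivRange π).toEquiv, mul_comm]
    exact π.ker.card_eq_card_quotient_mul_card_addSubgroup
  rw [Nat.card_congr (Equiv.subtypeEquivRight fun x => (hF x).symm)]
  change Nat.card F ≤ _
  rw [hcard]
  refine Nat.mul_le_mul ?_ ?_
  · -- `ker π` embeds into the fixed points on `Fin J → N`
    refine Nat.card_le_card_of_injective
      (fun x : π.ker => (⟨fun i => ⟨(x.1 : Fin J → M) i, ?_⟩, ?_⟩ :
        {y : Fin J → N // unipotentPow N J a y = y})) ?_
    · have hx : π x.1 = 0 := x.2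
      have := congrFun hx i
      exact (QuotientAddGroup.eq_zero_iff _).mp this
    · -- `N.subtype ∘ ((1+S)^a y) = (1+S)^a (N.subtype ∘ y) = (1+S)^a x = x = N.subtype ∘ y`
      have hxF : unipotentPow M J a (x.1 : Fin J → M) = (x.1 : Fin J → M) := (hF _).mp x.1.2
      have h := map_unipotentPow_apply N.subtype a (fun i => (⟨(x.1 : Fin J → M) i,
        (QuotientAddGroup.eq_zero_iff _).mp (congrFun (show π x.1 = 0 from x.2) i)⟩ : N))
      simp only [AddSubgroup.coe_subtype] at h
      funext i
      apply Subtype.ext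
      have hi := congrFun h i
      rw [hxF] at hi
      exact hi
    · intro x y hxy
      apply Subtype.ext; apply Subtype.ext
      funext i
      have := congrArg (fun z : {y : Fin J → N // unipotentPow N J a y = y} => ((z.1 i : N) : M)) hxy
      exact this
  · -- `range π` lies in the fixed points on `Fin J → M ⧸ N`
    refine Nat.card_le_card_of_injective
      (fun z : π.range => (⟨(z.1 : Fin J → M ⧸ N), ?_⟩ : {z : Fin J → M ⧸ N // unipotentPow (M ⧸ N) J a z = z})) ?_
    · obtain ⟨x, hx⟩ := z.2
      have hxF : unipotentPow M J a (x : Fin J → M) = (x : Fin J → M) := (hF _).mp x.2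
      rw [← hx]
      change unipotentPow (M ⧸ N) J a (fun i => QuotientAddGroup.mk' N ((x : Fin J → M) i)) =
        fun i => QuotientAddGroup.mk' N ((x : Fin J → M) i)
      rw [← map_unipotentPow_apply (QuotientAddGroup.mk' N) a, hxF]
    · intro z w hzw
      apply Subtype.ext
      have := congrArg Subtype.val hzw
      simpa only using this

/-- **`#Fix((1+S)^{p^m}) ≤ #M^{p^m}` on `Fin J → M` for every finite `M` with `p^k • M = 0`** (induction on `k` along
`0 → M[p] → M → M/M[p] → 0`: `M[p]` is `p`-torsion (§2), `M/M[p]` is `p^{k−1}`-torsion, `#M = #M[p]·#(M/M[p])`).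
[cite: Washington1997, §13.1–§13.2] [cite: MazurRubin2004, Lemma 5.3.1] -/
theorem natCard_fixed_unipotentPow_prime_pow_le :
    ∀ (k : ℕ) (M : Type u) [AddCommGroup M] [Finite M], (∀ x : M, p ^ k • x = 0) → ∀ (J m : ℕ),
      Nat.card {x : Fin J → M // unipotentPow M J (p ^ m) x = x} ≤ Nat.card M ^ p ^ m := by
  intro k
  induction k with
  | zero =>
    intro M _ _ hM J m
    have hsub : Subsingleton M := ⟨fun a b => by
      have ha := hM a; have hb := hM b
      rw [pow_zero, one_smul] at ha hb
      rw [ha, hb]⟩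
    haveI : Subsingleton (Fin J → M) := inferInstance
    calc Nat.card {x : Fin J → M // unipotentPow M J (p ^ m) x = x}
        ≤ Nat.card (Fin J → M) := Nat.card_le_card_of_injective (fun x => x.1) Subtype.val_injective
      _ = 1 := Nat.card_of_subsingleton 0
      _ ≤ Nat.card M ^ p ^ m := Nat.one_le_pow _ _ Nat.card_pos
  | succ k ih =>
    intro M _ _ hM J m
    -- the `p`-torsion `N = M[p]` and the quotient `M/N` (killed by `p^k`)
    let N : AddSubgroup M := (nsmulAddMonoidHom p : M →+ M).ker
    have hN : ∀ y : N, p • y = 0 := fun y => Subtype.ext (by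
      have := y.2
      change nsmulAddMonoidHom p (y : M) = 0 at this
      rw [nsmulAddMonoidHom_apply] at this
      rw [AddSubgroupClass.coe_nsmul, ZeroMemClass.coe_zero]
      exact this)
    have hQ : ∀ z : M ⧸ N, p ^ k • z = 0 := by
      intro z
      induction z using QuotientAddGroup.induction_on with
      | H x =>
        rw [← QuotientAddGroup.mk_nsmul, QuotientAddGroup.eq_zero_iff]
        change nsmulAddMonoidHom p (p ^ k • x) = 0
        rw [nsmulAddMonoidHom_apply, ← mul_nsmul', ← pow_succ', hM]
    calc Nat.card {x : Fin J → M // unipotentPow M J (p ^ m) x = x}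
        ≤ Nat.card {y : Fin J → N // unipotentPow N J (p ^ m) y = y} *
            Nat.card {z : Fin J → M ⧸ N // unipotentPow (M ⧸ N) J (p ^ m) z = z} :=
          natCard_fixed_unipotentPow_le_mul N (p ^ m)
      _ ≤ Nat.card N ^ p ^ m * Nat.card (M ⧸ N) ^ p ^ m :=
          Nat.mul_le_mul (natCard_fixed_unipotentPow_prime_pow_le_of_torsion hN m) (ih (M ⧸ N) hQ J m)
      _ = Nat.card M ^ p ^ m := by
          rw [← mul_pow, mul_comm, ← N.card_eq_card_quotient_mul_card_addSubgroup]

/-- **The fixed points of `(1+S)^N`, `N = p^m·u` with `p ∤ u`, on `Fin J → M` (`M` finite, `p^k • M = 0`) number at most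
`#M^{p^m}`** — the level-`p^k` form of the `n = 0` bound `natCard_fixedPoints_toLocal_twistModP_le_of_depth` (a `ρ`-trivial
element of depth `m` acts on `𝒯^{(k)}_J` as such a `(1+S)^N`). [cite: Washington1997, §13.1–§13.2] [cite: MazurRubin2004, Lemma 5.3.1] -/
theorem natCard_fixed_unipotentPow_le_of_coprime {M : Type u} [AddCommGroup M] [Finite M] {J k : ℕ}
    (hM : ∀ x : M, p ^ k • x = 0) {m u : ℕ} (hu : ¬ p ∣ u) :
    Nat.card {x : Fin J → M // unipotentPow M J (p ^ m * u) x = x} ≤ Nat.card M ^ p ^ m := by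
  rw [Nat.card_congr (Equiv.subtypeEquivRight fun x => unipotentPow_apply_eq_self_iff_of_coprime hM hu x)]
  exact natCard_fixed_unipotentPow_prime_pow_le k M hM J m

end Summit.BirchSwinnertonDyer.BirchSwinnertonDyer.Theorems.OneSidedTwistSqueezeX9KatoDivisibilityX9UnipotentFixedPointsPk

end
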